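import Summits.Ventures.LatticeQCDFlow.Scaling.HubClassChainTransitionLaw
import Summits.Ventures.LatticeQCDFlow.Scaling.HubChainDeepestTagDomination
import Summits.Ventures.LatticeQCDFlow.Scaling.HubChainPersistenceForm

/-!
HONEST FRAMING: exact (Metropolis-corrected) sampling algorithms for lattice gauge theory; figures
of merit are autocorrelation/cost numbers at stated couplings and volumes; no continuum-physics
claim.

# HubChainSeparableForm — THE SWAP PHASE SOLVED EXACTLY, XVI: THE RANK-SEPARABLE FORM OF THE SMITH–TIERNEY FUNCTION,
# `T_n(j) = cW_j·H_n(β_j,a_j) + c·Σ_{l>j} W_l·[H_n(β_l,a_l) − H_n(β_l,a_{l−1})]` WITH THE DEPTH-FREE LEVELS `a_l = 1 − c·M_{l+1}`: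
# EVERY RANK CONTRIBUTES ITS OWN PERSISTENCE TIMES A FIXED POLYNOMIAL OF ITS OWN EIGENVALUE (lean-2 GEN-40, ours)

Venture-side (OURS).  Cell `lqcd-flow` (pub-lqcd), unit `pub-lqcd-lean-2-g40`, 2026-08-30.  Chapter Z (Conjecture M′ settled), file 1.  Setting of chapter Y: depth ranks
`0,…,m−1` (`ρ > 0` non-decreasing, `W = 1/ρ` the persistence), class weights `N > 0` (the labelled chain is `N ≡ 1`), `R_k = Σ_{i<k}N_iρ_i`, `M_k = Σ_{i≥k}N_i`,
eigenvalues `β_k = 1 − c(M_k + R_k/ρ_k)` (files Y1∕Y7), and the Smith–Tierney function of the closed `n`-step law `Pⁿ(i,j) = N_jρ_j·T_n(max(i,j)) + β_iⁿδ_{ij}` (Y2∕Y8),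
`T_n(j) = (1−β_jⁿ)/R_m + Σ_{j<k<m}(1/R_k − 1/R_{k+1})(β_kⁿ − β_jⁿ)`.  With `H_n(x,y) = Σ_{t<n}xᵗyⁿ⁻¹⁻ᵗ` (Y9) and the DEPTH-FREE levels

  `a_l := 1 − c·M_{l+1}`  (`= 1 − c(m−1−l)` for the labelled chain; `a_{m−1} = 1`; `a_l − a_{l−1} = cN_l`; `a_j − β_j = cR_{j+1}W_j`, `a_{l−1} − β_l = cR_lW_l`),

partial fractions of the eigen-expansion give THE RANK-SEPARABLE FORM (`hubClass_T_separable`, labelled `hubChain_T_separable`):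

  **`T_n(j) = c·W_j·H_n(β_j,a_j) + c·Σ_{j<l<m} W_l·[H_n(β_l,a_l) − H_n(β_l,a_{l−1})]`,**

and two rewritings of the rank-`l` term (`hubClass_term_G`, `hubClass_term_R`):

  `c·W_l·[H_n(β_l,a_l) − H_n(β_l,a_{l−1})] = c²N_l·W_l·G_n(a_l,a_{l−1},β_l) = (cN_l/R_l)·[H_n(a_{l−1},a_l) − H_n(β_l,a_l)]`,

`G_n(a,a',b) = Σ_{q<n−1}a'^q·H_{n−1−q}(b,a)` the second divided difference of `zⁿ` (a polynomial with non-negative coefficients).  So the `n`-step law seen from the target is a sum over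
the ranks `l ≥ j` in which rank `l` enters ONLY through its own persistence `W_l`, its own eigenvalue `β_l` and the depth-free levels: in the `G`-form with `W_l` in front and a
polynomial NON-DECREASING in `β_l` on `[−a_l/2, ∞)`; in the `R`-form with `R_l` (the mass of the shallower ranks) in front and `−H_n(β_l,a_l)`, NON-INCREASING in `β_l` there.  This is
the top-rank split of file Y6 (`deepTag_T_split`) at EVERY rank, and it is what settles Conjecture M′ (file Z2): raising the depth of rank `s` moves `β_s` up (with `R_s` fixed) and every
deeper `β_l` down (with `W_l` fixed), and nothing else.

## What is proved

* §1 polynomial toolkit (hypothesis-equations `hH`, `hG`; no definitions): `sepH_zero/one/succ_left/succ_right/symm/scale`, **`sepH_mono`** (`H_n(·,a)` non-decreasing on `[−a/2,∞)`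
  for `a > 0`, from Y6's `geomPartial_mono`), `sepH_nonneg`, `sepG_succ` (`G_{n+1} = a'G_n + H_n(b,a)`), `sepG_mul` (`(a−a')G_n(a,a',b) = H_n(b,a) − H_n(b,a')`), **`sepG_mono`**,
  `sepH_three_term` (the exchange identity behind the `R`-form), `sep_telescope`.
* §2 class chain: `sep_a_sub_beta`, `sep_a_pred_sub_beta`, `sep_a_top`, `sep_a_step`, **`hubClass_T_separable`**, **`hubClass_term_G`**, **`hubClass_term_R`**.
* §3 labelled chain (`N ≡ 1`, `M_k = m−k`): **`hubChain_T_separable`**, `hubChain_term_G`, `hubChain_term_R`.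

Reading (no numerics implied): exact algebra; the monotonicity consequences (per-step domination off the tag, all cases) are file Z2.  TOY (`numerics/toy4.py`, `toy6.py`, exact rationals,
NOTHING CLAIMED): the three forms agree with the matrix powers in 16 992 + 47 224 instances.  Literature grade (cell rule): OWN, elementary (partial fractions of the finite
Liu ∕ Smith–Tierney expansion); nothing cited; no new bib keys.
-/

open Finset

namespace Summit.Ventures.LatticeQCDFlow.Scaling

/-! ### §1 Polynomial toolkit: `H_n(x,y) = Σ_{t<n}xᵗyⁿ⁻¹⁻ᵗ` and the second divided difference `G_n` -/
section Poly
variable {H : ℕ → ℝ → ℝ → ℝ} {G : ℕ → ℝ → ℝ → ℝ → ℝ}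

/-- `H_0 = 0`. [ours] -/
theorem sepH_zero (hH : ∀ n x y, H n x y = ∑ t ∈ range n, x ^ t * y ^ (n - 1 - t)) (x y : ℝ) : H 0 x y = 0 := by
  rw [hH]; simp

/-- `H_1 = 1`. [ours] -/
theorem sepH_one (hH : ∀ n x y, H n x y = ∑ t ∈ range n, x ^ t * y ^ (n - 1 - t)) (x y : ℝ) : H 1 x y = 1 := by
  rw [hH]; simp

/-- `H_{n+1}(x,a) = xⁿ + a·H_n(x,a)`. [ours] -/
theorem sepH_succ_left (hH : ∀ n x y, H n x y = ∑ t ∈ range n, x ^ t * y ^ (n - 1 - t)) (n : ℕ) (x a : ℝ) :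
    H (n + 1) x a = x ^ n + a * H n x a := by
  rw [hH, hH, sum_range_succ, mul_sum]
  have e : ∀ t ∈ range n, x ^ t * a ^ (n + 1 - 1 - t) = a * (x ^ t * a ^ (n - 1 - t)) := by
    intro t ht
    have ht' := mem_range.mp ht
    rw [show n + 1 - 1 - t = (n - 1 - t) + 1 by omega, pow_succ]; ring
  rw [sum_congr rfl e, show n + 1 - 1 - n = 0 by omega, pow_zero, mul_one, add_comm]

/-- `H_{n+1}(x,a) = aⁿ + x·H_n(x,a)`. [ours] -/
theorem sepH_succ_right (hH : ∀ n x y, H n x y = ∑ t ∈ range n, x ^ t * y ^ (n - 1 - t)) (n : ℕ) (x a : ℝ) :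
    H (n + 1) x a = a ^ n + x * H n x a := by
  rw [hH, hH, sum_range_succ', mul_sum]
  have e : ∀ t ∈ range n, x ^ (t + 1) * a ^ (n + 1 - 1 - (t + 1)) = x * (x ^ t * a ^ (n - 1 - t)) := by
    intro t ht
    have ht' := mem_range.mp ht
    rw [show n + 1 - 1 - (t + 1) = n - 1 - t by omega, pow_succ]; ring
  rw [sum_congr rfl e, pow_zero, one_mul, show n + 1 - 1 - 0 = n by omega, add_comm]

/-- `H_n` is symmetric. [ours] -/
theorem sepH_symm (hH : ∀ n x y, H n x y = ∑ t ∈ range n, x ^ t * y ^ (n - 1 - t)) (n : ℕ) (x y : ℝ) : H n x y = H n y x := by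
  rw [hH, hH]
  conv_rhs => rw [← Finset.sum_range_reflect]
  refine sum_congr rfl fun t ht => ?_
  have ht' := mem_range.mp ht
  rw [show n - 1 - (n - 1 - t) = t by omega, mul_comm]

/-- Scaling: `H_n(x,a) = aⁿ⁻¹·Σ_{t<n}(x/a)ᵗ` for `a ≠ 0`. [ours] -/
theorem sepH_scale (hH : ∀ n x y, H n x y = ∑ t ∈ range n, x ^ t * y ^ (n - 1 - t)) (n : ℕ) {x a : ℝ} (ha : a ≠ 0) :
    H n x a = a ^ (n - 1) * ∑ t ∈ range n, (x / a) ^ t := by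
  rw [hH, mul_sum]
  refine sum_congr rfl fun t ht => ?_
  have ht' := mem_range.mp ht
  rw [div_pow, show a ^ (n - 1) = a ^ (n - 1 - t) * a ^ t by rw [← pow_add]; congr 1; omega]
  have hat : a ^ t ≠ 0 := pow_ne_zero t ha
  field_simp

/-- **`H_n(·,a)` is non-decreasing on `[−a/2, ∞)`** for `a > 0` (Y6's `geomPartial_mono`, rescaled). [ours] -/
theorem sepH_mono (hH : ∀ n x y, H n x y = ∑ t ∈ range n, x ^ t * y ^ (n - 1 - t)) (n : ℕ) {x y a : ℝ} (ha : 0 < a)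
    (hx : 0 ≤ a + 2 * x) (hxy : x ≤ y) : H n x a ≤ H n y a := by
  rw [sepH_scale hH n ha.ne', sepH_scale hH n ha.ne']
  refine mul_le_mul_of_nonneg_left ?_ (pow_nonneg ha.le _)
  refine geomPartial_mono ?_ (div_le_div_of_nonneg_right hxy ha.le) n
  rw [le_div_iff₀ ha]; linarith

/-- `H_n(x,a) ≥ 0` for `a > 0`, `x ≥ −a/2`. [ours] -/
theorem sepH_nonneg (hH : ∀ n x y, H n x y = ∑ t ∈ range n, x ^ t * y ^ (n - 1 - t)) (n : ℕ) {x a : ℝ} (ha : 0 < a)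
    (hx : 0 ≤ a + 2 * x) : 0 ≤ H n x a := by
  rw [sepH_scale hH n ha.ne']
  refine mul_nonneg (pow_nonneg ha.le _) (geomPartial_nonneg ?_ n)
  rw [le_div_iff₀ ha]; linarith

/-- The recursion of the second divided difference: `G_{n+1}(a,a',b) = a'·G_n(a,a',b) + H_n(b,a)` (`G_0 = G_1 = 0`, `G_2 = 1`, `G_3 = a + a' + b`, …). [ours] -/
theorem sepG_succ (hH : ∀ n x y, H n x y = ∑ t ∈ range n, x ^ t * y ^ (n - 1 - t))
    (hG : ∀ n a a' b, G n a a' b = ∑ q ∈ range (n - 1), a' ^ q * H (n - 1 - q) b a) (n : ℕ) (a a' b : ℝ) :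
    G (n + 1) a a' b = a' * G n a a' b + H n b a := by
  rcases n with _ | n
  · rw [hG, hG, sepH_zero hH]; simp
  · rw [hG, hG, show n + 1 + 1 - 1 = n + 1 by omega, sum_range_succ', show n + 1 - 1 = n by omega, mul_sum, pow_zero, one_mul,
      show n + 1 - 0 = n + 1 by omega]
    congr 1
    refine sum_congr rfl fun q hq => ?_
    have hq' := mem_range.mp hq
    rw [show n + 1 - (q + 1) = n - q by omega, pow_succ]; ring

/-- **`(a − a')·G_n(a,a',b) = H_n(b,a) − H_n(b,a')`.** [ours] -/
theorem sepG_mul (hH : ∀ n x y, H n x y = ∑ t ∈ range n, x ^ t * y ^ (n - 1 - t))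
    (hG : ∀ n a a' b, G n a a' b = ∑ q ∈ range (n - 1), a' ^ q * H (n - 1 - q) b a) (n : ℕ) (a a' b : ℝ) :
    (a - a') * G n a a' b = H n b a - H n b a' := by
  induction n with
  | zero => rw [hG, sepH_zero hH, sepH_zero hH]; simp
  | succ n ih =>
      rw [sepG_succ hH hG, sepH_succ_left hH n b a, sepH_succ_left hH n b a']
      linear_combination a' * ih

/-- **`G_n(a,a',·)` is non-decreasing on `[−a/2, ∞)`** for `a > 0`, `a' ≥ 0`. [ours] -/
theorem sepG_mono (hH : ∀ n x y, H n x y = ∑ t ∈ range n, x ^ t * y ^ (n - 1 - t))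
    (hG : ∀ n a a' b, G n a a' b = ∑ q ∈ range (n - 1), a' ^ q * H (n - 1 - q) b a) (n : ℕ) {a a' b b' : ℝ} (ha : 0 < a) (ha' : 0 ≤ a')
    (hb : 0 ≤ a + 2 * b) (hbb : b ≤ b') : G n a a' b ≤ G n a a' b' := by
  rw [hG, hG]
  exact sum_le_sum fun q _ => mul_le_mul_of_nonneg_left (sepH_mono hH _ ha hb hbb) (pow_nonneg ha' q)

/-- `G_n(a,a',b) ≥ 0` for `a > 0`, `a' ≥ 0`, `b ≥ −a/2`. [ours] -/
theorem sepG_nonneg (hH : ∀ n x y, H n x y = ∑ t ∈ range n, x ^ t * y ^ (n - 1 - t))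
    (hG : ∀ n a a' b, G n a a' b = ∑ q ∈ range (n - 1), a' ^ q * H (n - 1 - q) b a) (n : ℕ) {a a' b : ℝ} (ha : 0 < a) (ha' : 0 ≤ a')
    (hb : 0 ≤ a + 2 * b) : 0 ≤ G n a a' b := by
  rw [hG]
  exact sum_nonneg fun q _ => mul_nonneg (pow_nonneg ha' q) (sepH_nonneg hH _ ha hb)

/-- The exchange identity behind the `R`-form: `(a' − b)·[H_n(b,a) − H_n(b,a')] = (a − a')·[H_n(a',a) − H_n(b,a)]`. [ours] -/
theorem sepH_three_term (hH : ∀ n x y, H n x y = ∑ t ∈ range n, x ^ t * y ^ (n - 1 - t)) (n : ℕ) (a a' b : ℝ) :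
    (a' - b) * (H n b a - H n b a') = (a - a') * (H n a' a - H n b a) := by
  have h1 := hubChain_H_mul hH n b a
  have h2 := hubChain_H_mul hH n b a'
  have h3 := hubChain_H_mul hH n a' a
  linear_combination (-1 : ℝ) * h1 + h2 + h3

/-- Telescoping over the ranks: `Σ_{l∈[j+1,m)} (g(l) − g(l−1)) = g(m−1) − g(j)` for `j + 1 ≤ m`. [ours] -/
theorem sep_telescope (g : ℕ → ℝ) {j m : ℕ} (hjm : j + 1 ≤ m) : ∑ l ∈ Ico (j + 1) m, (g l - g (l - 1)) = g (m - 1) - g j := by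
  obtain ⟨d, hd⟩ : ∃ d, m = j + 1 + d := ⟨m - (j + 1), by omega⟩
  subst hd
  clear hjm
  induction d with
  | zero => simp
  | succ d ih =>
      rw [show j + 1 + (d + 1) = j + 1 + d + 1 by omega, Finset.sum_Ico_succ_top (by omega : j + 1 ≤ j + 1 + d), ih,
        show j + 1 + d + 1 - 1 = j + 1 + d by omega, show j + 1 + d - 1 = j + d by omega]
      ring

end Poly

/-! ### §2 The rank-separable form for the class-weighted chain -/
section ClassSep
variable {m : ℕ} {ρ N R M β a : ℕ → ℝ} {c : ℝ} {T : ℕ → ℕ → ℝ} {H : ℕ → ℝ → ℝ → ℝ} {G : ℕ → ℝ → ℝ → ℝ → ℝ}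

/-- `a_j − β_j = c·R_{j+1}/ρ_j` (`a_j = 1 − cM_{j+1}`, `M_j = N_j + M_{j+1}`, `R_{j+1} = R_j + N_jρ_j`). [ours] -/
theorem sep_a_sub_beta (hρ : ∀ i, 0 < ρ i) (hR : ∀ k, R k = ∑ i ∈ range k, N i * ρ i) (hM : ∀ k, M k = ∑ i ∈ Ico k m, N i)
    (hβ : ∀ k, β k = 1 - c * (M k + R k / ρ k)) (ha : ∀ l, a l = 1 - c * M (l + 1)) {j : ℕ} (hj : j < m) :
    a j - β j = c * R (j + 1) / ρ j := by
  rw [ha, hβ, hubClass_M_succ hM hj, hR (j + 1), sum_range_succ, ← hR j]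
  have hρj := (hρ j).ne'
  field_simp
  ring

/-- `a_{l−1} − β_l = c·R_l/ρ_l` for `l ≥ 1`. [ours] -/
theorem sep_a_pred_sub_beta (hβ : ∀ k, β k = 1 - c * (M k + R k / ρ k)) (ha : ∀ l, a l = 1 - c * M (l + 1)) {l : ℕ} (hl : 1 ≤ l) :
    a (l - 1) - β l = c * R l / ρ l := by
  rw [ha, hβ, show l - 1 + 1 = l by omega]; ring

/-- `a_{m−1} = 1` (`M_m = 0`), for `m ≥ 1`. [ours] -/
theorem sep_a_top (hM : ∀ k, M k = ∑ i ∈ Ico k m, N i) (ha : ∀ l, a l = 1 - c * M (l + 1)) (hm : 1 ≤ m) : a (m - 1) = 1 := by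
  rw [ha, show m - 1 + 1 = m by omega, hM m, Finset.Ico_self, sum_empty, mul_zero, sub_zero]

/-- `a_l − a_{l−1} = c·N_l` for `1 ≤ l < m`. [ours] -/
theorem sep_a_step (hM : ∀ k, M k = ∑ i ∈ Ico k m, N i) (ha : ∀ l, a l = 1 - c * M (l + 1)) {l : ℕ} (hl1 : 1 ≤ l) (hl : l < m) :
    a l - a (l - 1) = c * N l := by
  rw [ha, ha, show l - 1 + 1 = l by omega, hubClass_M_succ hM hl]; ring

/-- **THE RANK-SEPARABLE FORM (class weights).**  For `j < m`,
`T_n(j) = c·(1/ρ_j)·H_n(β_j,a_j) + c·Σ_{j<l<m} (1/ρ_l)·[H_n(β_l,a_l) − H_n(β_l,a_{l−1})]`, `a_l = 1 − cM_{l+1}`. [ours] -/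
theorem hubClass_T_separable (hρ : ∀ i, 0 < ρ i) (hN : ∀ i, 0 < N i) (hR : ∀ k, R k = ∑ i ∈ range k, N i * ρ i)
    (hM : ∀ k, M k = ∑ i ∈ Ico k m, N i) (hβ : ∀ k, β k = 1 - c * (M k + R k / ρ k)) (ha : ∀ l, a l = 1 - c * M (l + 1))
    (hT : ∀ n j, T n j = (1 - β j ^ n) / R m + ∑ k ∈ Ico (j + 1) m, (1 / R k - 1 / R (k + 1)) * (β k ^ n - β j ^ n))
    (hH : ∀ n x y, H n x y = ∑ t ∈ range n, x ^ t * y ^ (n - 1 - t)) (n : ℕ) {j : ℕ} (hj : j < m) :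
    T n j = c * (1 / ρ j) * H n (β j) (a j) + c * ∑ l ∈ Ico (j + 1) m, (1 / ρ l) * (H n (β l) (a l) - H n (β l) (a (l - 1))) := by
  have hRpos : ∀ k, 1 ≤ k → 0 < R k := fun k hk => by
    rw [hR k]; exact sum_pos (fun i _ => mul_pos (hN i) (hρ i)) ⟨0, mem_range.mpr (by omega)⟩
  -- the eigen-expansion of `T` (file Y2∕Y8), expanded by the telescoping sum of file Y1
  have hTexp : T n j = 1 / R m - β j ^ n / R (j + 1) + ∑ k ∈ Ico (j + 1) m, β k ^ n * (1 / R k - 1 / R (k + 1)) := by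
    rw [hT]
    have e : ∑ k ∈ Ico (j + 1) m, (1 / R k - 1 / R (k + 1)) * (β k ^ n - β j ^ n)
        = ∑ k ∈ Ico (j + 1) m, β k ^ n * (1 / R k - 1 / R (k + 1)) - β j ^ n * ∑ k ∈ Ico (j + 1) m, (1 / R k - 1 / R (k + 1)) := by
      rw [mul_sum, ← sum_sub_distrib]; exact sum_congr rfl fun k _ => by ring
    rw [e, hubChain_telescope hj]
    ring
  -- the rank-`j` term
  have hA : c * (1 / ρ j) * H n (β j) (a j) = a j ^ n / R (j + 1) - β j ^ n / R (j + 1) := by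
    have hmul := hubChain_H_mul hH n (β j) (a j)
    have hab := sep_a_sub_beta hρ hR hM hβ ha hj
    have hRj := (hRpos (j + 1) (by omega)).ne'
    have hρj := (hρ j).ne'
    rw [← sub_div, eq_div_iff hRj]
    have : a j ^ n - β j ^ n = H n (β j) (a j) * (c * R (j + 1) / ρ j) := by rw [← hab]; linear_combination hmul
    rw [this]; field_simp
  -- the rank-`l` terms
  have hB : ∀ l ∈ Ico (j + 1) m, c * ((1 / ρ l) * (H n (β l) (a l) - H n (β l) (a (l - 1))))
      = (a l ^ n / R (l + 1) - a (l - 1) ^ n / R (l - 1 + 1)) + β l ^ n * (1 / R l - 1 / R (l + 1)) := by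
    intro l hl
    have hl' : j + 1 ≤ l ∧ l < m := by simpa using mem_Ico.mp hl
    rw [show l - 1 + 1 = l by omega]
    have hmul1 := hubChain_H_mul hH n (β l) (a l)
    have hmul2 := hubChain_H_mul hH n (β l) (a (l - 1))
    have hab1 := sep_a_sub_beta hρ hR hM hβ ha hl'.2
    have hab2 := sep_a_pred_sub_beta hβ ha (by omega : 1 ≤ l)
    have hRl := (hRpos l (by omega)).ne'
    have hRl1 := (hRpos (l + 1) (by omega)).ne'
    have hρl := (hρ l).ne'
    have e1 : a l ^ n - β l ^ n = H n (β l) (a l) * (c * R (l + 1) / ρ l) := by rw [← hab1]; linear_combination hmul1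
    have e2 : a (l - 1) ^ n - β l ^ n = H n (β l) (a (l - 1)) * (c * R l / ρ l) := by rw [← hab2]; linear_combination hmul2
    have g1 : c * (1 / ρ l) * H n (β l) (a l) = (a l ^ n - β l ^ n) / R (l + 1) := by rw [e1]; field_simp
    have g2 : c * (1 / ρ l) * H n (β l) (a (l - 1)) = (a (l - 1) ^ n - β l ^ n) / R l := by rw [e2]; field_simp
    have : c * ((1 / ρ l) * (H n (β l) (a l) - H n (β l) (a (l - 1)))) = c * (1 / ρ l) * H n (β l) (a l) - c * (1 / ρ l) * H n (β l) (a (l - 1)) := by ring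
    rw [this, g1, g2]
    field_simp
    ring
  have htel := sep_telescope (fun l => a l ^ n / R (l + 1)) (by omega : j + 1 ≤ m)
  rw [hTexp, mul_sum, sum_congr rfl hB, sum_add_distrib, htel, sep_a_top hM ha (by omega : 1 ≤ m), one_pow, show m - 1 + 1 = m by omega, hA]
  ring

/-- **The `G`-form of the rank-`l` term:** `c·(1/ρ_l)·[H_n(β_l,a_l) − H_n(β_l,a_{l−1})] = c²·N_l·(1/ρ_l)·G_n(a_l,a_{l−1},β_l)` for `1 ≤ l < m`. [ours] -/
theorem hubClass_term_G (hM : ∀ k, M k = ∑ i ∈ Ico k m, N i) (ha : ∀ l, a l = 1 - c * M (l + 1))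
    (hH : ∀ n x y, H n x y = ∑ t ∈ range n, x ^ t * y ^ (n - 1 - t))
    (hG : ∀ n a a' b, G n a a' b = ∑ q ∈ range (n - 1), a' ^ q * H (n - 1 - q) b a) (n : ℕ) {l : ℕ} (hl1 : 1 ≤ l) (hl : l < m) :
    c * (1 / ρ l) * (H n (β l) (a l) - H n (β l) (a (l - 1))) = c ^ 2 * N l * (1 / ρ l) * G n (a l) (a (l - 1)) (β l) := by
  rw [← sepG_mul hH hG n (a l) (a (l - 1)) (β l), sep_a_step hM ha hl1 hl]; ring

/-- **The `R`-form of the rank-`l` term:** `c·(1/ρ_l)·[H_n(β_l,a_l) − H_n(β_l,a_{l−1})] = (cN_l/R_l)·[H_n(a_{l−1},a_l) − H_n(β_l,a_l)]` for `1 ≤ l < m`. [ours] -/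
theorem hubClass_term_R (hρ : ∀ i, 0 < ρ i) (hN : ∀ i, 0 < N i) (hR : ∀ k, R k = ∑ i ∈ range k, N i * ρ i)
    (hM : ∀ k, M k = ∑ i ∈ Ico k m, N i) (hβ : ∀ k, β k = 1 - c * (M k + R k / ρ k)) (ha : ∀ l, a l = 1 - c * M (l + 1))
    (hH : ∀ n x y, H n x y = ∑ t ∈ range n, x ^ t * y ^ (n - 1 - t)) (n : ℕ) {l : ℕ} (hl1 : 1 ≤ l) (hl : l < m) :
    c * (1 / ρ l) * (H n (β l) (a l) - H n (β l) (a (l - 1))) = c * N l / R l * (H n (a (l - 1)) (a l) - H n (β l) (a l)) := by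
  have hRl : 0 < R l := by rw [hR l]; exact sum_pos (fun i _ => mul_pos (hN i) (hρ i)) ⟨0, mem_range.mpr (by omega)⟩
  have hρl := (hρ l).ne'
  have hx := sepH_three_term hH n (a l) (a (l - 1)) (β l)
  rw [sep_a_pred_sub_beta hβ ha hl1, sep_a_step hM ha hl1 hl] at hx
  -- `hx : (cR_l/ρ_l)·ΔH = cN_l·(H(a',a) − H(b,a))`
  have e : c * N l / R l * (H n (a (l - 1)) (a l) - H n (β l) (a l)) = (c * R l / ρ l * (H n (β l) (a l) - H n (β l) (a (l - 1)))) / R l := by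
    rw [hx]; ring
  rw [e]
  field_simp

end ClassSep

/-! ### §3 The labelled chain (`N ≡ 1`) -/
section LabelledSep
variable {m : ℕ} {ρ R β a : ℕ → ℝ} {c : ℝ} {T : ℕ → ℕ → ℝ} {H : ℕ → ℝ → ℝ → ℝ} {G : ℕ → ℝ → ℝ → ℝ → ℝ}

/-- The labelled data are class data with unit weights: `R_k = Σ_{i<k}1·ρ_i`, `M_k = m − k = Σ_{i∈[k,m)}1`. [ours] -/
theorem sep_labelled_M (m k : ℕ) : (((m - k : ℕ) : ℝ)) = ∑ i ∈ Ico k m, (fun _ : ℕ => (1 : ℝ)) i := by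
  rw [sum_const, Nat.card_Ico, nsmul_eq_mul, mul_one]

/-- **THE RANK-SEPARABLE FORM (labelled chain).**  With `a_l = 1 − c(m−1−l)`, for `j < m`:
`T_n(j) = c·(1/ρ_j)·H_n(β_j,a_j) + c·Σ_{j<l<m}(1/ρ_l)·[H_n(β_l,a_l) − H_n(β_l,a_{l−1})]`. [ours] -/
theorem hubChain_T_separable (hρ : ∀ i, 0 < ρ i) (hR : ∀ k, R k = ∑ i ∈ range k, ρ i)
    (hβ : ∀ k, β k = 1 - c * (((m - k : ℕ) : ℝ) + R k / ρ k)) (ha : ∀ l, a l = 1 - c * ((m - 1 - l : ℕ) : ℝ))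
    (hT : ∀ n j, T n j = (1 - β j ^ n) / R m + ∑ k ∈ Ico (j + 1) m, (1 / R k - 1 / R (k + 1)) * (β k ^ n - β j ^ n))
    (hH : ∀ n x y, H n x y = ∑ t ∈ range n, x ^ t * y ^ (n - 1 - t)) (n : ℕ) {j : ℕ} (hj : j < m) :
    T n j = c * (1 / ρ j) * H n (β j) (a j) + c * ∑ l ∈ Ico (j + 1) m, (1 / ρ l) * (H n (β l) (a l) - H n (β l) (a (l - 1))) := by
  have hR' : ∀ k, R k = ∑ i ∈ range k, (fun _ : ℕ => (1 : ℝ)) i * ρ i := fun k => by rw [hR k]; simp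
  have hβ' : ∀ k, β k = 1 - c * ((fun k => ((m - k : ℕ) : ℝ)) k + R k / ρ k) := fun k => by rw [hβ k]
  have ha' : ∀ l, a l = 1 - c * (fun k => ((m - k : ℕ) : ℝ)) (l + 1) := fun l => by rw [ha l, show m - 1 - l = m - (l + 1) by omega]
  exact hubClass_T_separable hρ (fun _ => one_pos) hR' (fun k => sep_labelled_M m k) hβ' ha' hT hH n hj

/-- The `G`-form of the rank-`l` term (labelled): `c(1/ρ_l)[H_n(β_l,a_l) − H_n(β_l,a_{l−1})] = c²(1/ρ_l)G_n(a_l,a_{l−1},β_l)`, `1 ≤ l < m`. [ours] -/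
theorem hubChain_term_G (ha : ∀ l, a l = 1 - c * ((m - 1 - l : ℕ) : ℝ))
    (hH : ∀ n x y, H n x y = ∑ t ∈ range n, x ^ t * y ^ (n - 1 - t))
    (hG : ∀ n a a' b, G n a a' b = ∑ q ∈ range (n - 1), a' ^ q * H (n - 1 - q) b a) (n : ℕ) {l : ℕ} (hl1 : 1 ≤ l) (hl : l < m) :
    c * (1 / ρ l) * (H n (β l) (a l) - H n (β l) (a (l - 1))) = c ^ 2 * (1 / ρ l) * G n (a l) (a (l - 1)) (β l) := by
  have ha' : ∀ l, a l = 1 - c * (fun k => ((m - k : ℕ) : ℝ)) (l + 1) := fun l => by rw [ha l, show m - 1 - l = m - (l + 1) by omega]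
  have h := hubClass_term_G (ρ := ρ) (β := β) (fun k => sep_labelled_M m k) ha' hH hG n hl1 hl
  rw [h]; ring

/-- The `R`-form of the rank-`l` term (labelled): `c(1/ρ_l)[H_n(β_l,a_l) − H_n(β_l,a_{l−1})] = (c/R_l)[H_n(a_{l−1},a_l) − H_n(β_l,a_l)]`, `1 ≤ l < m`. [ours] -/
theorem hubChain_term_R (hρ : ∀ i, 0 < ρ i) (hR : ∀ k, R k = ∑ i ∈ range k, ρ i)
    (hβ : ∀ k, β k = 1 - c * (((m - k : ℕ) : ℝ) + R k / ρ k)) (ha : ∀ l, a l = 1 - c * ((m - 1 - l : ℕ) : ℝ))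
    (hH : ∀ n x y, H n x y = ∑ t ∈ range n, x ^ t * y ^ (n - 1 - t)) (n : ℕ) {l : ℕ} (hl1 : 1 ≤ l) (hl : l < m) :
    c * (1 / ρ l) * (H n (β l) (a l) - H n (β l) (a (l - 1))) = c / R l * (H n (a (l - 1)) (a l) - H n (β l) (a l)) := by
  have hR' : ∀ k, R k = ∑ i ∈ range k, (fun _ : ℕ => (1 : ℝ)) i * ρ i := fun k => by rw [hR k]; simp
  have hβ' : ∀ k, β k = 1 - c * ((fun k => ((m - k : ℕ) : ℝ)) k + R k / ρ k) := fun k => by rw [hβ k]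
  have ha' : ∀ l, a l = 1 - c * (fun k => ((m - k : ℕ) : ℝ)) (l + 1) := fun l => by rw [ha l, show m - 1 - l = m - (l + 1) by omega]
  have h := hubClass_term_R hρ (fun _ => one_pos) hR' (fun k => sep_labelled_M m k) hβ' ha' hH n hl1 hl
  rw [h]; ring

end LabelledSep

end Summit.Ventures.LatticeQCDFlow.Scaling
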